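/-
Copyright (c) 2026 the pub-hodgecm-mathlib formalisation cell (harness21).  Prover seat hodgecm-mathlib-F0P2-p06 (g10): road «S3-tree» (LEAD F0P3a-plan (g11), architect
A-p16 (g29) rulings A-63 (1) ∕ A-66 (3)(4) «T2-E′ = THE LOCAL FIXED-SPHERE DICTIONARY; the residual-action head first — S-a3 consumes it»), brick T2-E′, FILE 3; 2026-09-01.
-/
import Literature.NumberTheory.Automorphic.UnitaryLatticeTreeFixedCostar   -- ★ T2-E′ FILE 2 (F0P2-p06 (g10)): `mapGL_sup_span_eq_iff` (the form-free fixed-costar test)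
import HarnessLib

/-!
# The lattice graph of a hermitian space — T2-E′ FILE 3: COORDINATES ON `N₁^♯ ∕ N₁ ≅ 𝓀²`, THE RESIDUAL ACTION OF `Stab(N₁)`, AND «SELF-DUAL NEIGHBOURS = ISOTROPIC POINTS»
# at the standard type-two vertex `N₁ = latt diag(1,1,ϖ)` of the `U(3)` tree (Bruhat–Tits 1972 §10; Tits 1979 §3.5; Jacobowitz 1962 §7–§8)

Topic `NumberTheory/Automorphic`; namespace `Literature.NumberTheory.Automorphic.UnitaryLatticeTree`.  THEOREMS ONLY (no definition, no instance, no notation, no named fact,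
no `sorry`); kernel lane.  Cell `pub/hodgecm-mathlib` (D-0151), crux H413 = `stmt-HodgeConjecture-24833`; road «S3-tree» (census «S3» v3 0ca147ac), brick **T2-E′ «THE LOCAL
FIXED-SPHERE DICTIONARY»**, FILE 3 = the COORDINATE form of the type-two half (sequel of ★ FILE 2 `UnitaryLatticeTreeFixedCostar`), cut as the input of S-a3 «a residually
unipotent element of a type-two vertex stabiliser fixes a self-dual neighbour» (architect A-66 (3); holder F0P3a-p07 (g11)).
THE MATHEMATICS (`K` with `Valued K ℤᵐ⁰`, uniformiser `ϖ`, `σ` valuation-preserving with `σϖ = ϖ` where marked; `J₀ = antidiag(1,1,1)`, `B₀ σ 3` its pairing;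
`N₁ = latt diag(1,1,ϖ) = 𝒪e₀ ⊕ 𝒪e₁ ⊕ ϖ𝒪e₂`, `N₁^♯ = latt diag(ϖ⁻¹,1,1)`).  The residual plane `N₁^♯ ∕ N₁ ≅ 𝓀²` has COORDINATES `(ā, b̄)` through the vectors
`w(a,b) := (a∕ϖ, 0, b)`, `a, b ∈ 𝒪` (§1: every `w ∈ N₁^♯` is `≡ w(ϖw₀, w₂)`; `w(a,b) ∈ N₁ ↔ |a|, |b| < 1`, so `w(a,b)` is LEVEL ONE iff `(a,b)` is PRIMITIVE; `ϖw(a,b) ∈ N₁`).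
An element `γ ∈ U(σ, J₀)` with `γ·N₁ = N₁` also fixes `N₁^♯` (§2, ★ `dualLatt_mapGL`), hence `γ(ϖ⁻¹e₀), γe₂ ∈ N₁^♯`, which bounds its entries and gives THE RESIDUAL ACTION
(§2): **`γ·w(a,b) ≡ w(γ₀₀a + ϖγ₀₂b, ϖ⁻¹γ₂₀a + γ₂₂b) (mod N₁)`** with INTEGRAL new coordinates — `γ̄` acts on `𝓀²` by `R(γ) = [[γ₀₀, ϖγ₀₂],[ϖ⁻¹γ₂₀, γ₂₂]] mod 𝔪`.
With ★ FILE 2's form-free test this yields (§3) **the type-two fixed-star test in coordinates**: for primitive `(a,b)`, `γ·(N₁ + 𝒪w) = N₁ + 𝒪w ↔ ∃ c ∈ 𝒪^×, |a′ − ca|, |b′ − cb| < 1`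
(`R̄(γ)` fixes `[ā : b̄]`), and (§3) **«SELF-DUAL NEIGHBOURS = ISOTROPIC POINTS»**: `N₁ + 𝒪w(a,b)` is a self-dual vertex iff `σ(a)b + σ(b)a ∈ 𝔪` — the residual form of the
plane is the hyperbolic `h̄((a,b),(a′,b′)) = σ(a)b′ + σ(b)a′ = ϖ·B₀(w(a,b), w(a′,b′))` ((⇒) `L ≤ L^♯`; (⇐) `|a| < 1`: `L = 𝒪³ = L₀`; `|a| = 1`: `L = latt [w | e₁ | ϖe₂]` with Gram matrix
`[[(σ(a)b+σ(b)a)∕ϖ, 0, σa],[0, 1, 0],[a, 0, 0]]`, unimodular).  Its `q + 1` points: `[0:1]` (`L₀`) and `[1:b]`, `b + σb ∈ 𝔪`.  S-a3 then reads: `γ` residually unipotent ⇒ `R̄(γ)` a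
unipotent isometry of `h̄` ⇒ it fixes an isotropic point (`R̄ = 1`: `[1:0]`; else `Im(R̄ − 1)`, isotropic by ★ B-p08's transvection lemma) ⇒ `γ` fixes that self-dual neighbour.
HONEST LABEL: HC_CM is proved only modulo the 2 remaining named inputs (hLiu418 24832, h413 24833) until rung 0 closes; nothing printed is asserted here (elementary lattice
algebra over a valuation ring); S3 (`stub_N6nsS3id`) stays a print row until the road's END lands.

* §1 `smul_ϖ_vec_mem_N₁`, **`vec_mem_N₁_iff`**, `sub_vec_mem_N₁_of_mem_dual`.
* §2 `mapGL_dual_N₁_eq` (`Stab(N₁) ≤ U` fixes `N₁^♯`), **`mulVec_vec_sub_vec_mem_N₁`** (THE RESIDUAL ACTION, integral coordinates; hypothesis only `γ·N₁^♯ ≤ N₁^♯`, `γ ∈ GL₃(K)`).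
* §3 **`mapGL_N₁_sup_span_vec_eq_iff`** (fixed-star test in coordinates), **`isSelfDualLattice_N₁_sup_span_vec_iff`** (self-dual ↔ isotropic; `σ` an involution preserving `v`, `σϖ = ϖ`).

## References
* [BruhatTits1972] F. Bruhat, J. Tits, *Groupes réductifs sur un corps local I*, Publ. Math. IHÉS 41 (1972), §10 (lattice models; the star of a vertex = the residual building).
* [Tits1979] J. Tits, *Reductive groups over local fields*, PSPM 33.1 (1979), §3.5 (reduction mod `𝔭`: the stabiliser acts on the star through its reductive quotient).
* [Jacobowitz1962] R. Jacobowitz, *Hermitian forms over local fields*, Amer. J. Math. 84 (1962), §4 (duals), §7–§8 (unimodular ∕ modular hermitian lattices).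
* [Serre1980Trees] J.-P. Serre, *Trees* (1980), Ch. II §1.1 (neighbours of a lattice = lines of its reduction).
-/

set_option autoImplicit false

noncomputable section

open scoped Valued WithZero Matrix MatrixGroups

namespace Literature.NumberTheory.Automorphic.UnitaryLatticeTree

open Literature.NumberTheory.Automorphic Literature.NumberTheory.Automorphic.HermitianLattice

variable {K : Type*} [Field K] [Valued K ℤᵐ⁰]

/-! ## §1 Coordinates `w(a,b) = (a∕ϖ, 0, b)` on `N₁^♯ ∕ N₁` -/

section Coordinates

variable {σ : K →+* K} {ϖ : K}

/-- `ϖ·w(a,b) ∈ N₁` for the coordinate vector `w(a,b) = (a∕ϖ, 0, b)`, `a, b ∈ 𝒪`: every `w(a,b)` is at most level one over `N₁`. [cite: BruhatTits1972, §10] -/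
theorem smul_ϖ_vec_mem_N₁ (hϖ : Valued.v ϖ = WithZero.exp (-1 : ℤ)) {a b : K} (ha : Valued.v a ≤ 1) (hb : Valued.v b ≤ 1) :
    ϖ • (![a / ϖ, 0, b] : Fin 3 → K) ∈ latt (Matrix.diagonal ![(1 : K), 1, ϖ]) := by
  have hϖ0 : ϖ ≠ 0 := fun h0 => by rw [h0, map_zero] at hϖ; exact WithZero.coe_ne_zero hϖ.symm
  have hd' : ∀ i, (![(1 : K), 1, ϖ] : Fin 3 → K) i ≠ 0 := by intro i; fin_cases i <;> simp [hϖ0]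
  refine (mem_latt_diagonal_iff hd' _).2 fun i => ?_
  fin_cases i
  · simp [mul_div_cancel₀ a hϖ0, ha]
  · simp
  · simp [map_mul, mul_le_of_le_one_right' hb]

/-- **`w(a,b) ∈ N₁ ↔ |a| < 1 ∧ |b| < 1`** (`a, b ∈ 𝒪`): the coordinate vector `w(a,b) = (a∕ϖ, 0, b)` represents the class `(ā, b̄)` of `N₁^♯ ∕ N₁ ≅ 𝓀²`, and it is
LEVEL ONE (`∉ N₁`) iff `(a, b)` is primitive. [cite: BruhatTits1972, §10] [cite: Serre1980Trees, II.1.1] -/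
theorem vec_mem_N₁_iff (hϖ : Valued.v ϖ = WithZero.exp (-1 : ℤ)) (a b : K) :
    (![a / ϖ, 0, b] : Fin 3 → K) ∈ latt (Matrix.diagonal ![(1 : K), 1, ϖ]) ↔ Valued.v a < 1 ∧ Valued.v b < 1 := by
  have hϖ0 : ϖ ≠ 0 := fun h0 => by rw [h0, map_zero] at hϖ; exact WithZero.coe_ne_zero hϖ.symm
  have hvϖ0 : Valued.v ϖ ≠ 0 := (Valuation.ne_zero_iff _).2 hϖ0
  have hlt : ∀ z : K, Valued.v z < 1 ↔ Valued.v z ≤ Valued.v ϖ := fun z => by rw [hϖ]; exact v_lt_one_iff z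
  have hd' : ∀ i, (![(1 : K), 1, ϖ] : Fin 3 → K) i ≠ 0 := by intro i; fin_cases i <;> simp [hϖ0]
  rw [mem_latt_diagonal_iff hd', Fin.forall_fin_succ, Fin.forall_fin_two]
  simp only [Fin.succ_zero_eq_one, Fin.succ_one_eq_two, Matrix.cons_val_zero, Matrix.cons_val_one, Matrix.cons_val_two, Matrix.tail_cons, Matrix.head_cons,
    map_one, map_zero, zero_le, true_and, map_div₀, div_le_one₀ (zero_lt_iff.2 hvϖ0), hlt]

/-- **Every `w ∈ N₁^♯ = latt diag(ϖ⁻¹, 1, 1)` has coordinates**: `a = ϖ·w₀`, `b = w₂` are integral and `w ≡ w(a,b) (mod N₁)`. [cite: BruhatTits1972, §10] -/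
theorem sub_vec_mem_N₁_of_mem_dual (hϖ : Valued.v ϖ = WithZero.exp (-1 : ℤ)) {w : Fin 3 → K} (hw : w ∈ latt (Matrix.diagonal ![ϖ⁻¹, (1 : K), 1])) :
    Valued.v (ϖ * w 0) ≤ 1 ∧ Valued.v (w 2) ≤ 1 ∧ w - ![ϖ * w 0 / ϖ, 0, w 2] ∈ latt (Matrix.diagonal ![(1 : K), 1, ϖ]) := by
  have hϖ0 : ϖ ≠ 0 := fun h0 => by rw [h0, map_zero] at hϖ; exact WithZero.coe_ne_zero hϖ.symm
  have hvϖ0 : Valued.v ϖ ≠ 0 := (Valuation.ne_zero_iff _).2 hϖ0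
  have hd : ∀ i, (![ϖ⁻¹, (1 : K), 1] : Fin 3 → K) i ≠ 0 := by intro i; fin_cases i <;> simp [hϖ0]
  have hd' : ∀ i, (![(1 : K), 1, ϖ] : Fin 3 → K) i ≠ 0 := by intro i; fin_cases i <;> simp [hϖ0]
  rw [mem_latt_diagonal_iff hd] at hw
  have h0 := hw 0; have h1 := hw 1; have h2 := hw 2
  simp only [Matrix.cons_val_zero, Matrix.cons_val_one, Matrix.cons_val_two, Matrix.tail_cons, Matrix.head_cons,
    Nat.succ_eq_add_one, map_inv₀, map_one] at h0 h1 h2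
  refine ⟨?_, h2, (mem_latt_diagonal_iff hd' _).2 fun i => ?_⟩
  · rw [map_mul]
    calc Valued.v ϖ * Valued.v (w 0) ≤ Valued.v ϖ * (Valued.v ϖ)⁻¹ := mul_le_mul_right h0 _
      _ = 1 := mul_inv_cancel₀ hvϖ0
  · fin_cases i
    · simp [mul_div_cancel_left₀ (w 0) hϖ0]
    · simp [h1]
    · simp

/-! ## §2 The residual action of `Stab(N₁)` -/

/-- **`Stab(N₁)` fixes `N₁^♯`**: for `γ ∈ U(σ, J₀)` with `γ·N₁ = N₁`, `γ·N₁^♯ = N₁^♯ = latt diag(ϖ⁻¹, 1, 1)` (★ `dualLatt_mapGL` + ★ `dualLatt_latt_diagonal_three`;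
`σ` valuation-preserving with `σϖ = ϖ`). [cite: Jacobowitz1962, §4] [cite: BruhatTits1972, §10] -/
theorem mapGL_dual_N₁_eq (hvσ : ∀ a, Valued.v (σ a) = Valued.v a) (hσϖ : σ ϖ = ϖ) (hϖ : Valued.v ϖ = WithZero.exp (-1 : ℤ))
    (γ : unitaryGroupOfForm σ ((StdForm.antidiagonal 3).over K))
    (hγ : mapGL (γ : GL (Fin 3) K) (latt (Matrix.diagonal ![(1 : K), 1, ϖ])) = latt (Matrix.diagonal ![(1 : K), 1, ϖ])) :
    mapGL (γ : GL (Fin 3) K) (latt (Matrix.diagonal ![ϖ⁻¹, (1 : K), 1])) = latt (Matrix.diagonal ![ϖ⁻¹, (1 : K), 1]) := by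
  have hϖ0 : ϖ ≠ 0 := fun h0 => by rw [h0, map_zero] at hϖ; exact WithZero.coe_ne_zero hϖ.symm
  have hdual : dualLatt σ ((StdForm.antidiagonal 3).over K) (latt (Matrix.diagonal ![(1 : K), 1, ϖ])) = latt (Matrix.diagonal ![ϖ⁻¹, (1 : K), 1]) := by
    have h := dualLatt_latt_diagonal_three (K := K) hvσ hσϖ hϖ0 0 0 1
    simp only [zpow_zero, zpow_one, neg_zero, zpow_neg] at h
    exact h
  rw [← hdual, ← dualLatt_mapGL γ.2, hγ]

/-- **THE RESIDUAL ACTION ON `N₁^♯ ∕ N₁` IN COORDINATES**: if `γ ∈ GL₃(K)` maps `N₁^♯ = latt diag(ϖ⁻¹,1,1)` into itself (e.g. `γ ∈ Stab(N₁) ≤ U(σ,J₀)`, by `mapGL_dual_N₁_eq`),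
then for `a, b ∈ 𝒪` the image `γ·w(a,b)` is congruent mod `N₁` to `w(a′, b′)` with the INTEGRAL coordinates
`a′ = γ₀₀·a + ϖγ₀₂·b`, `b′ = ϖ⁻¹γ₂₀·a + γ₂₂·b` — i.e. `γ̄` acts on `𝓀²` by the matrix `[[γ₀₀, ϖγ₀₂], [ϖ⁻¹γ₂₀, γ₂₂]] mod 𝔪` (integral because `γ(ϖ⁻¹e₀), γe₂ ∈ N₁^♯`).
[cite: BruhatTits1972, §10] [cite: Tits1979, §3.5] -/
theorem mulVec_vec_sub_vec_mem_N₁ (hϖ : Valued.v ϖ = WithZero.exp (-1 : ℤ)) {γ : GL (Fin 3) K}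
    (hγ : mapGL γ (latt (Matrix.diagonal ![ϖ⁻¹, (1 : K), 1])) ≤ latt (Matrix.diagonal ![ϖ⁻¹, (1 : K), 1])) {a b : K} (ha : Valued.v a ≤ 1) (hb : Valued.v b ≤ 1) :
    Valued.v ((γ : Matrix (Fin 3) (Fin 3) K) 0 0 * a + ϖ * (γ : Matrix (Fin 3) (Fin 3) K) 0 2 * b) ≤ 1 ∧
      Valued.v (ϖ⁻¹ * (γ : Matrix (Fin 3) (Fin 3) K) 2 0 * a + (γ : Matrix (Fin 3) (Fin 3) K) 2 2 * b) ≤ 1 ∧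
      (γ : Matrix (Fin 3) (Fin 3) K).mulVec ![a / ϖ, 0, b] -
          ![((γ : Matrix (Fin 3) (Fin 3) K) 0 0 * a + ϖ * (γ : Matrix (Fin 3) (Fin 3) K) 0 2 * b) / ϖ, 0,
            ϖ⁻¹ * (γ : Matrix (Fin 3) (Fin 3) K) 2 0 * a + (γ : Matrix (Fin 3) (Fin 3) K) 2 2 * b] ∈
        latt (Matrix.diagonal ![(1 : K), 1, ϖ]) := by
  have hϖ0 : ϖ ≠ 0 := fun h0 => by rw [h0, map_zero] at hϖ; exact WithZero.coe_ne_zero hϖ.symm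
  have hvϖ0 : Valued.v ϖ ≠ 0 := (Valuation.ne_zero_iff _).2 hϖ0
  have hd : ∀ i, (![ϖ⁻¹, (1 : K), 1] : Fin 3 → K) i ≠ 0 := by intro i; fin_cases i <;> simp [hϖ0]
  have hd' : ∀ i, (![(1 : K), 1, ϖ] : Fin 3 → K) i ≠ 0 := by intro i; fin_cases i <;> simp [hϖ0]
  set G : Matrix (Fin 3) (Fin 3) K := (γ : Matrix (Fin 3) (Fin 3) K) with hG
  -- the columns `γ(ϖ⁻¹ e₀)` and `γ e₂` lie in `N₁^♯`: entry bounds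
  have hcol : ∀ (y : Fin 3 → K), y ∈ latt (Matrix.diagonal ![ϖ⁻¹, (1 : K), 1]) → G.mulVec y ∈ latt (Matrix.diagonal ![ϖ⁻¹, (1 : K), 1]) :=
    fun y hy => hγ ⟨y, hy, by rw [LinearMap.restrictScalars_apply, Matrix.toLin'_apply]⟩
  have hy0 : (ϖ⁻¹ • Pi.single 0 1 : Fin 3 → K) ∈ latt (Matrix.diagonal ![ϖ⁻¹, (1 : K), 1]) := by
    refine (mem_latt_diagonal_iff hd _).2 fun i => ?_
    fin_cases i <;> simp
  have hy2 : (Pi.single 2 1 : Fin 3 → K) ∈ latt (Matrix.diagonal ![ϖ⁻¹, (1 : K), 1]) := by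
    refine (mem_latt_diagonal_iff hd _).2 fun i => ?_
    fin_cases i <;> simp
  have hc0 := (mem_latt_diagonal_iff hd _).1 (hcol _ hy0)
  have hc2 := (mem_latt_diagonal_iff hd _).1 (hcol _ hy2)
  rw [Matrix.mulVec_smul, Matrix.mulVec_single_one] at hc0
  rw [Matrix.mulVec_single_one] at hc2
  have hcol0 : ∀ i, (ϖ⁻¹ • G.col 0) i = ϖ⁻¹ * G i 0 := fun i => rfl
  have hcol2 : ∀ i, G.col 2 i = G i 2 := fun i => rfl
  simp only [hcol0] at hc0
  simp only [hcol2] at hc2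
  have e00 := hc0 0; have e10 := hc0 1; have e20 := hc0 2; have e02 := hc2 0; have e12 := hc2 1; have e22 := hc2 2
  simp only [Matrix.cons_val_zero, Matrix.cons_val_one, Matrix.cons_val_two, Matrix.tail_cons, Matrix.head_cons,
    Nat.succ_eq_add_one, map_inv₀, map_one] at e00 e10 e20 e02 e12 e22
  -- `|γ₀₀| ≤ 1`, `|ϖ⁻¹γ₁₀| ≤ 1`, `|ϖ⁻¹γ₂₀| ≤ 1`, `|ϖ γ₀₂| ≤ 1`, `|γ₁₂| ≤ 1`, `|γ₂₂| ≤ 1`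
  have b00 : Valued.v (G 0 0) ≤ 1 := by
    rw [map_mul, map_inv₀] at e00
    have := mul_le_mul_right e00 (Valued.v ϖ)
    rwa [← mul_assoc, mul_inv_cancel₀ hvϖ0, one_mul] at this
  have b02 : Valued.v (ϖ * G 0 2) ≤ 1 := by
    rw [map_mul]
    have := mul_le_mul_right e02 (Valued.v ϖ)
    rwa [mul_inv_cancel₀ hvϖ0] at this
  have b20 : Valued.v (ϖ⁻¹ * G 2 0) ≤ 1 := e20
  have b10 : Valued.v (ϖ⁻¹ * G 1 0) ≤ 1 := e10
  refine ⟨?_, ?_, ?_⟩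
  · refine (Valuation.map_add _ _ _).trans (max_le ?_ ?_)
    · rw [map_mul]; exact mul_le_one' b00 ha
    · rw [map_mul]; exact mul_le_one' b02 hb
  · refine (Valuation.map_add _ _ _).trans (max_le ?_ ?_)
    · rw [map_mul]; exact mul_le_one' b20 ha
    · rw [map_mul]; exact mul_le_one' e22 hb
  · refine (mem_latt_diagonal_iff hd' _).2 fun i => ?_
    have hmv : ∀ i, (G.mulVec ![a / ϖ, 0, b]) i = G i 0 * (a / ϖ) + G i 2 * b := by
      intro i; simp [Matrix.mulVec, dotProduct, Fin.sum_univ_three]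
    fin_cases i
    · simp only [Fin.zero_eta, Pi.sub_apply, hmv, Matrix.cons_val_zero, map_one]
      rw [show G 0 0 * (a / ϖ) + G 0 2 * b - (G 0 0 * a + ϖ * G 0 2 * b) / ϖ = 0 by field_simp; ring, map_zero]
      exact zero_le
    · simp only [Fin.mk_one, Pi.sub_apply, hmv, Matrix.cons_val_one, Matrix.cons_val_zero, sub_zero, map_one]
      refine (Valuation.map_add _ _ _).trans (max_le ?_ ?_)
      · rw [show G 1 0 * (a / ϖ) = (ϖ⁻¹ * G 1 0) * a by field_simp, map_mul]; exact mul_le_one' b10 ha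
      · rw [map_mul]; exact mul_le_one' e12 hb
    · simp only [Fin.reduceFinMk, Pi.sub_apply, hmv, Matrix.cons_val_two, Matrix.tail_cons, Matrix.head_cons, Nat.succ_eq_add_one]
      rw [show G 2 0 * (a / ϖ) + G 2 2 * b - (ϖ⁻¹ * G 2 0 * a + G 2 2 * b) = 0 by field_simp; ring, map_zero]
      exact zero_le

/-! ## §3 The fixed-star test in coordinates; self-dual neighbours = isotropic points -/

/-- **THE TYPE-TWO FIXED-STAR TEST IN COORDINATES** (S-a3's dictionary): for `γ ∈ U(σ, J₀)` with `γ·N₁ = N₁` and a PRIMITIVE `(a, b) ∈ 𝒪²`, `γ` fixes the self-dual ∕ superlattice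
neighbour `N₁ + 𝒪w(a,b)` of `N₁` iff the residual matrix `[[γ₀₀, ϖγ₀₂], [ϖ⁻¹γ₂₀, γ₂₂]]` fixes the point `[ā : b̄] ∈ ℙ¹(𝓀)`:
`γ·(N₁ + 𝒪w) = N₁ + 𝒪w ↔ ∃ c, |c| = 1 ∧ |γ₀₀a + ϖγ₀₂b − c·a| < 1 ∧ |ϖ⁻¹γ₂₀a + γ₂₂b − c·b| < 1`. [cite: BruhatTits1972, §10] [cite: Tits1979, §3.5] -/
theorem mapGL_N₁_sup_span_vec_eq_iff (hvσ : ∀ a, Valued.v (σ a) = Valued.v a) (hσϖ : σ ϖ = ϖ) (hϖ : Valued.v ϖ = WithZero.exp (-1 : ℤ))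
    (γ : unitaryGroupOfForm σ ((StdForm.antidiagonal 3).over K))
    (hγ : mapGL (γ : GL (Fin 3) K) (latt (Matrix.diagonal ![(1 : K), 1, ϖ])) = latt (Matrix.diagonal ![(1 : K), 1, ϖ]))
    {a b : K} (ha : Valued.v a ≤ 1) (hb : Valued.v b ≤ 1) (hprim : Valued.v a = 1 ∨ Valued.v b = 1) :
    mapGL (γ : GL (Fin 3) K) (latt (Matrix.diagonal ![(1 : K), 1, ϖ]) ⊔ Submodule.span 𝒪[K] {(![a / ϖ, 0, b] : Fin 3 → K)}) =
        latt (Matrix.diagonal ![(1 : K), 1, ϖ]) ⊔ Submodule.span 𝒪[K] {(![a / ϖ, 0, b] : Fin 3 → K)} ↔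
      ∃ c : K, Valued.v c = 1 ∧
        Valued.v (((γ : GL (Fin 3) K) : Matrix (Fin 3) (Fin 3) K) 0 0 * a + ϖ * ((γ : GL (Fin 3) K) : Matrix (Fin 3) (Fin 3) K) 0 2 * b - c * a) < 1 ∧
        Valued.v (ϖ⁻¹ * ((γ : GL (Fin 3) K) : Matrix (Fin 3) (Fin 3) K) 2 0 * a + ((γ : GL (Fin 3) K) : Matrix (Fin 3) (Fin 3) K) 2 2 * b - c * b) < 1 := by
  have hϖ0 : ϖ ≠ 0 := fun h0 => by rw [h0, map_zero] at hϖ; exact WithZero.coe_ne_zero hϖ.symm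
  have hwM : (![a / ϖ, 0, b] : Fin 3 → K) ∉ latt (Matrix.diagonal ![(1 : K), 1, ϖ]) := by
    rw [vec_mem_N₁_iff hϖ a b]
    rintro ⟨ha', hb'⟩
    rcases hprim with h | h
    · exact (lt_irrefl _) (h ▸ ha')
    · exact (lt_irrefl _) (h ▸ hb')
  rw [mapGL_sup_span_eq_iff hϖ hγ (smul_ϖ_vec_mem_N₁ hϖ ha hb) hwM]
  obtain ⟨ha', hb', hcongr⟩ := mulVec_vec_sub_vec_mem_N₁ hϖ (γ := (γ : GL (Fin 3) K)) (mapGL_dual_N₁_eq hvσ hσϖ hϖ γ hγ).le ha hb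
  set a' := ((γ : GL (Fin 3) K) : Matrix (Fin 3) (Fin 3) K) 0 0 * a + ϖ * ((γ : GL (Fin 3) K) : Matrix (Fin 3) (Fin 3) K) 0 2 * b with ha'_def
  set b' := ϖ⁻¹ * ((γ : GL (Fin 3) K) : Matrix (Fin 3) (Fin 3) K) 2 0 * a + ((γ : GL (Fin 3) K) : Matrix (Fin 3) (Fin 3) K) 2 2 * b with hb'_def
  refine exists_congr fun c => and_congr_right fun hc => ?_
  -- `γw − c w ≡ w(a′ − ca, b′ − cb) (mod N₁)`
  have hsplit : ((γ : GL (Fin 3) K) : Matrix (Fin 3) (Fin 3) K).mulVec ![a / ϖ, 0, b] - c • (![a / ϖ, 0, b] : Fin 3 → K) =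
      (((γ : GL (Fin 3) K) : Matrix (Fin 3) (Fin 3) K).mulVec ![a / ϖ, 0, b] - ![a' / ϖ, 0, b']) + ![(a' - c * a) / ϖ, 0, b' - c * b] := by
    have hvec : (![(a' - c * a) / ϖ, 0, b' - c * b] : Fin 3 → K) = ![a' / ϖ, 0, b'] - c • (![a / ϖ, 0, b] : Fin 3 → K) := by
      funext i; fin_cases i <;> simp
      ring
    rw [hvec, sub_add_sub_cancel]
  rw [hsplit, ← vec_mem_N₁_iff hϖ (a' - c * a) (b' - c * b)]
  constructor
  · intro h
    have := Submodule.sub_mem _ h hcongr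
    rwa [add_sub_cancel_left] at this
  · intro h; exact Submodule.add_mem _ hcongr h

/-- **SELF-DUAL NEIGHBOURS OF `N₁` ↔ ISOTROPIC POINTS OF THE RESIDUAL HYPERBOLIC PLANE**: for a primitive `(a, b) ∈ 𝒪²` the superlattice `N₁ + 𝒪w(a,b)` is a SELF-DUAL vertex
iff `σ(a)b + σ(b)a ∈ 𝔪` — the residual form of `N₁^♯ ∕ N₁` is `ϖ·B₀(w(a,b), w(a′,b′)) = σ(a)b′ + σ(b)a′` (`σ` an involution preserving `v`, `σϖ = ϖ`).  (⇒) `L ≤ L^♯` gives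
`B₀(w,w) = (σ(a)b + σ(b)a)∕ϖ ∈ 𝒪`; (⇐) `|a| < 1`: `L = 𝒪³`; `|a| = 1`: `L = latt [w | e₁ | ϖe₂]` with Gram matrix `[[(σ(a)b+σ(b)a)∕ϖ, 0, σa], [0, 1, 0], [a, 0, 0]]`, unimodular.
The `q + 1` points: `[0:1]` (`L = 𝒪³ = L₀`) and `[1:b]`, `b + σb ∈ 𝔪`. [cite: BruhatTits1972, §10] [cite: Jacobowitz1962, §7–§8] [cite: Serre1980Trees, II.1.1] -/
theorem isSelfDualLattice_N₁_sup_span_vec_iff (hσ : ∀ x, σ (σ x) = x) (hvσ : ∀ a, Valued.v (σ a) = Valued.v a) (hσϖ : σ ϖ = ϖ)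
    (hϖ : Valued.v ϖ = WithZero.exp (-1 : ℤ)) {a b : K} (ha : Valued.v a ≤ 1) (hb : Valued.v b ≤ 1) (hprim : Valued.v a = 1 ∨ Valued.v b = 1) :
    IsSelfDualLattice σ ϖ ((StdForm.antidiagonal 3).over K) (latt (Matrix.diagonal ![(1 : K), 1, ϖ]) ⊔ Submodule.span 𝒪[K] {(![a / ϖ, 0, b] : Fin 3 → K)}) ↔
      Valued.v (σ a * b + σ b * a) < 1 := by
  have hϖ0 : ϖ ≠ 0 := fun h0 => by rw [h0, map_zero] at hϖ; exact WithZero.coe_ne_zero hϖ.symm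
  have hvϖ0 : Valued.v ϖ ≠ 0 := (Valuation.ne_zero_iff _).2 hϖ0
  have hϖ1 : Valued.v ϖ ≤ 1 := by rw [hϖ, ← WithZero.exp_zero]; exact WithZero.exp_le_exp.2 (by norm_num)
  have hlt : ∀ z : K, Valued.v z < 1 ↔ Valued.v z ≤ Valued.v ϖ := fun z => by rw [hϖ]; exact v_lt_one_iff z
  have hd' : ∀ i, (![(1 : K), 1, ϖ] : Fin 3 → K) i ≠ 0 := by intro i; fin_cases i <;> simp [hϖ0]
  -- the self-pairing of `w(a,b)`
  have hB : B₀ σ 3 (![a / ϖ, 0, b] : Fin 3 → K) ![a / ϖ, 0, b] = (σ a * b + σ b * a) / ϖ := by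
    simp [B₀_apply, Fin.sum_univ_three, Fin.rev, map_div₀, hσϖ]
    field_simp
  constructor
  · -- (⇒) `L ≤ L^♯` ⇒ `B₀(w,w) ∈ 𝒪`
    intro hL
    have hw : (![a / ϖ, 0, b] : Fin 3 → K) ∈ latt (Matrix.diagonal ![(1 : K), 1, ϖ]) ⊔ Submodule.span 𝒪[K] {(![a / ϖ, 0, b] : Fin 3 → K)} :=
      Submodule.mem_sup_right (Submodule.mem_span_singleton_self _)
    have h1 := (mem_dualLatt σ _ _ _).1 (le_dualLatt_of_isVertexLattice hvσ hL hw) _ hw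
    rw [pairing_antidiagonal, hB, map_div₀, div_le_one₀ (zero_lt_iff.2 hvϖ0)] at h1
    exact (hlt _).2 h1
  · intro hiso
    by_cases ha1 : Valued.v a = 1
    · -- `|a| = 1`: `L = latt g`, `g = [w | e₁ | ϖe₂]`
      have ha0 : a ≠ 0 := fun h0 => by rw [h0, map_zero] at ha1; exact zero_ne_one ha1
      set g : Matrix (Fin 3) (Fin 3) K := !![a / ϖ, 0, 0; 0, 1, 0; b, 0, ϖ] with hg
      have hgdet : g.det = a := by rw [hg, Matrix.det_fin_three]; simp; field_simp
      have hgdet0 : g.det ≠ 0 := by rw [hgdet]; exact ha0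
      have hcol0 : g.mulVec (Pi.single 0 1) = ![a / ϖ, 0, b] := by
        rw [Matrix.mulVec_single_one]; funext i; fin_cases i <;> simp [hg]
      have hcol1 : g.mulVec (Pi.single 1 1) = Pi.single 1 1 := by
        rw [Matrix.mulVec_single_one]; funext i; fin_cases i <;> simp [hg]
      have hcol2 : g.mulVec (Pi.single 2 1) = ϖ • Pi.single 2 1 := by
        rw [Matrix.mulVec_single_one]; funext i; fin_cases i <;> simp [hg]
      have hL : latt (Matrix.diagonal ![(1 : K), 1, ϖ]) ⊔ Submodule.span 𝒪[K] {(![a / ϖ, 0, b] : Fin 3 → K)} = latt g := by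
        apply le_antisymm
        · refine sup_le ((latt_le_iff_forall_mulVec_single_mem _ _).2 fun j => ?_) ((Submodule.span_singleton_le_iff_mem _ _).2 ?_)
          · fin_cases j
            · -- `e₀ = (ϖ∕a)·w − (b∕a)·(ϖe₂)`
              have hmem : ((⟨ϖ / a, (Valuation.mem_integer_iff _ _).2 (by rw [map_div₀, ha1, div_one]; exact hϖ1)⟩ : 𝒪[K]) • g.mulVec (Pi.single 0 1) -
                  (⟨b / a, (Valuation.mem_integer_iff _ _).2 (by rw [map_div₀, ha1, div_one]; exact hb)⟩ : 𝒪[K]) • g.mulVec (Pi.single 2 1)) ∈ latt g :=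
                Submodule.sub_mem _ (Submodule.smul_mem _ _ (mulVec_single_mem_latt g 0)) (Submodule.smul_mem _ _ (mulVec_single_mem_latt g 2))
              have heq : ((⟨ϖ / a, (Valuation.mem_integer_iff _ _).2 (by rw [map_div₀, ha1, div_one]; exact hϖ1)⟩ : 𝒪[K]) • g.mulVec (Pi.single 0 1) -
                  (⟨b / a, (Valuation.mem_integer_iff _ _).2 (by rw [map_div₀, ha1, div_one]; exact hb)⟩ : 𝒪[K]) • g.mulVec (Pi.single 2 1) : Fin 3 → K) =
                  (Matrix.diagonal ![(1 : K), 1, ϖ]).mulVec (Pi.single 0 1) := by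
                change (ϖ / a) • g.mulVec (Pi.single 0 1) - (b / a) • g.mulVec (Pi.single 2 1) = _
                rw [hcol0, hcol2, Matrix.mulVec_single_one]
                funext i; fin_cases i <;> simp <;> field_simp
                ring
              rw [Fin.zero_eta, ← heq]; exact hmem
            · have : (Matrix.diagonal ![(1 : K), 1, ϖ]).mulVec (Pi.single 1 1) = g.mulVec (Pi.single 1 1) := by
                rw [hcol1, Matrix.mulVec_single_one]; funext i; fin_cases i <;> simp
              rw [Fin.mk_one, this]; exact mulVec_single_mem_latt g 1
            · have : (Matrix.diagonal ![(1 : K), 1, ϖ]).mulVec (Pi.single 2 1) = g.mulVec (Pi.single 2 1) := by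
                rw [hcol2, Matrix.mulVec_single_one]; funext i; fin_cases i <;> simp
              simp only [Fin.reduceFinMk]; rw [this]; exact mulVec_single_mem_latt g 2
          · rw [← hcol0]; exact mulVec_single_mem_latt g 0
        · refine (latt_le_iff_forall_mulVec_single_mem _ _).2 fun j => ?_
          fin_cases j
          · rw [Fin.zero_eta, hcol0]; exact Submodule.mem_sup_right (Submodule.mem_span_singleton_self _)
          · rw [Fin.mk_one, hcol1]
            exact Submodule.mem_sup_left ((mem_latt_diagonal_iff hd' _).2 fun i => by fin_cases i <;> simp)
          · simp only [Fin.reduceFinMk]; rw [hcol2]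
            exact Submodule.mem_sup_left ((mem_latt_diagonal_iff hd' _).2 fun i => by fin_cases i <;> simp)
      rw [hL]
      -- the Gram matrix of `g`
      have hJ : ∀ i j : Fin 3, (StdForm.antidiagonal 3).over K i j = if j = Fin.rev i then (1 : K) else 0 := by
        intro i j
        simp only [StdForm.over, Matrix.map_apply, StdForm.antidiagonal_J_apply]
        split_ifs <;> simp
      have hG : formCongr σ (Matrix.GeneralLinearGroup.mkOfDetNeZero _ hgdet0) ((StdForm.antidiagonal 3).over K) =
          !![(σ a * b + σ b * a) / ϖ, 0, σ a; 0, 1, 0; a, 0, 0] := by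
        rw [formCongr, Matrix.GeneralLinearGroup.val_mkOfDetNeZero]
        ext i j
        fin_cases i <;> fin_cases j <;> simp [Matrix.mul_apply, Fin.sum_univ_three, hg, hJ, hσϖ, Fin.rev, Matrix.map_apply, map_div₀] <;> field_simp
        ring
      have hGdet : (!![(σ a * b + σ b * a) / ϖ, 0, σ a; 0, 1, 0; a, 0, 0] : Matrix (Fin 3) (Fin 3) K).det = -(σ a * a) := by
        rw [Matrix.det_fin_three]; simp
      have hGint : IsIntMatrix (!![(σ a * b + σ b * a) / ϖ, 0, σ a; 0, 1, 0; a, 0, 0] : Matrix (Fin 3) (Fin 3) K) := by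
        intro i j
        fin_cases i <;> fin_cases j <;> simp [hvσ, ha]
        rw [div_le_one₀ (zero_lt_iff.2 hvϖ0)]; exact (hlt _).1 hiso
      have hvdet : Valued.v (!![(σ a * b + σ b * a) / ϖ, 0, σ a; 0, 1, 0; a, 0, 0] : Matrix (Fin 3) (Fin 3) K).det = 1 := by
        rw [hGdet, Valuation.map_neg, map_mul, hvσ, ha1, one_mul]
      refine ⟨Matrix.GeneralLinearGroup.mkOfDetNeZero _ hgdet0, by rw [Matrix.GeneralLinearGroup.val_mkOfDetNeZero], ?_, ?_, ?_⟩
      · rw [hG]; exact hGint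
      · rw [hG]; intro i j; rw [Matrix.smul_apply, smul_eq_mul, map_mul]; exact mul_le_one' hϖ1 (isIntMatrix_nonsing_inv_of_v_det_eq_one hGint hvdet i j)
      · rw [hG, hvdet, pow_zero]
    · -- `|a| < 1`, hence `|b| = 1` (primitive): `L = 𝒪³ = L₀`
      have hb1 : Valued.v b = 1 := hprim.resolve_left ha1
      · have halt : Valued.v a < 1 := lt_of_le_of_ne ha ha1
        have hb0 : b ≠ 0 := fun h0 => by rw [h0, map_zero] at hb1; exact zero_ne_one hb1
        have hL : latt (Matrix.diagonal ![(1 : K), 1, ϖ]) ⊔ Submodule.span 𝒪[K] {(![a / ϖ, 0, b] : Fin 3 → K)} = stdLattice K 3 := by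
          apply le_antisymm
          · refine sup_le (scaleLattice_stdLattice_le_N₁_le hϖ1 hϖ0).2 ((Submodule.span_singleton_le_iff_mem _ _).2 fun i => ?_)
            fin_cases i
            · simp only [Fin.zero_eta, Matrix.cons_val_zero, map_div₀, div_le_one₀ (zero_lt_iff.2 hvϖ0)]; exact (hlt _).1 halt
            · simp
            · simpa using hb
          · -- `𝒪³ = latt 1`; `e₀, e₁ ∈ N₁`, `e₂ = b⁻¹·(w − (a∕ϖ)·e₀)`
            rw [← latt_one]
            refine (latt_le_iff_forall_mulVec_single_mem _ _).2 fun j => ?_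
            rw [Matrix.one_mulVec]
            fin_cases j
            · exact Submodule.mem_sup_left ((mem_latt_diagonal_iff hd' _).2 fun i => by fin_cases i <;> simp)
            · exact Submodule.mem_sup_left ((mem_latt_diagonal_iff hd' _).2 fun i => by fin_cases i <;> simp)
            · have haϖ : Valued.v (a / ϖ) ≤ 1 := by rw [map_div₀, div_le_one₀ (zero_lt_iff.2 hvϖ0)]; exact (hlt _).1 halt
              have hbinv : Valued.v b⁻¹ ≤ 1 := by rw [map_inv₀, hb1, inv_one]
              have hmem : ((⟨b⁻¹, (Valuation.mem_integer_iff _ _).2 hbinv⟩ : 𝒪[K]) •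
                  ((![a / ϖ, 0, b] : Fin 3 → K) - (⟨a / ϖ, (Valuation.mem_integer_iff _ _).2 haϖ⟩ : 𝒪[K]) • (![1, 0, 0] : Fin 3 → K))) ∈
                  latt (Matrix.diagonal ![(1 : K), 1, ϖ]) ⊔ Submodule.span 𝒪[K] {(![a / ϖ, 0, b] : Fin 3 → K)} :=
                Submodule.smul_mem _ _ (Submodule.sub_mem _ (Submodule.mem_sup_right (Submodule.mem_span_singleton_self _))
                  (Submodule.smul_mem _ _ (Submodule.mem_sup_left ((mem_latt_diagonal_iff hd' _).2 fun i => by fin_cases i <;> simp))))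
              have heq : ((⟨b⁻¹, (Valuation.mem_integer_iff _ _).2 hbinv⟩ : 𝒪[K]) •
                  ((![a / ϖ, 0, b] : Fin 3 → K) - (⟨a / ϖ, (Valuation.mem_integer_iff _ _).2 haϖ⟩ : 𝒪[K]) • (![1, 0, 0] : Fin 3 → K)) : Fin 3 → K) =
                  ![0, 0, 1] := by
                change b⁻¹ • ((![a / ϖ, 0, b] : Fin 3 → K) - (a / ϖ) • (![1, 0, 0] : Fin 3 → K)) = ![0, 0, 1]
                funext i; fin_cases i <;> simp [hb0]
              have hsingle : (Pi.single 2 1 : Fin 3 → K) = ![0, 0, 1] := by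
                funext i; fin_cases i <;> simp
              simp only [Fin.reduceFinMk]; rw [hsingle, ← heq]; exact hmem
        rw [hL, ← latt_diagonal_zpow_zero (ϖ := ϖ)]
        exact isSelfDualLattice_latt_diagonal_zpow hσ hσϖ hϖ1 hϖ0 0

end Coordinates


end Literature.NumberTheory.Automorphic.UnitaryLatticeTree

end
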